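import Mathlib.NumberTheory.Padics.RingHoms
import Mathlib.GroupTheory.Index
import Mathlib.GroupTheory.OrderOfElement
import Mathlib.Analysis.SpecificLimits.Basic
import HarnessLib

/-!
# Crux `PrintCf2.SplitBadTwoRankOneOfFacts` (stmt-BirchSwinnertonDyer-20368), road α v10.3, S3c bottom value — LOCAL POINTS, file 1:
# THE `p`-ADIC SCALAR OF AN ADDITIVE ENDOMORPHISM OF A GROUP `G ⊇ ℤ_p` OF FINITE INDEX (pure algebra)

Cell `bsd-print-cf2`, width seat `bsd-line-cf2-p1-w7` g3 (successor of -w7 g2's bottom-value lane, memo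
`Cruxes/SplitBadTwoRankOneOfFacts/BOTTOM-VALUE-SNAKE-w7g2-v2.md` §2); `--supports stmt-BirchSwinnertonDyer-20368` (helper, Theses-free).
HONEST FRAMING: nothing here closes a crux or a stub; BSD is not proved by any of this; no summit statement is proved by this seat.
No definition, no named fact, no `sorry`, no kit. beyond-print theorem: no (bookkeeping).

WHY. The two displayed LOCAL inputs (H1′) «`Q_M ≤ ker loc_v`» and (H2) «`loc_{v̄}(𝔖_v ⊓ L_M) ⊆ loc_{v̄}(Q_M)`» of -w7 g2's
`rBV_of_three_factor_values` (p665606), and the local index (F1), are statements about the `𝓞_K ⊗ ℤ₂`-module `E(K_w) ⊗ ℤ₂`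
(`w ∈ {v, v̄}`, `K_w ≅ ℚ₂`): by Silverman VII.6.3, `E(K_w) ⊇ U ≃+ ℤ₂` of finite index, so `E(K_w)/tors` is a `ℤ₂`-LINE and the CM
endomorphism `π` (`π² = π − 2`) acts on it by ONE of the two `2`-adic roots `r`, `1 − r` of `X² − X + 2`. This file is the pure
algebra of that remark, for an abstract additive group `G` with a finite-index subgroup `U ≃+ ℤ_p` and an additive `f : G → G`:
* `exists_coord` — coordinates `ξ : G →+ ℚ_p` (`ξ = e(m·x)/m`, `m = [G : U]`): kernel = torsion, `ξ|_U = e`, `‖ξ‖ ≤ ‖m‖⁻¹`, and the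
  image is a `ℤ_p`-module; `eq_mul_of_bounded` — a BOUNDED additive map `ℤ_p → ℚ_p` is `z ↦ z·φ(1)` (every additive endomorphism of
  `ℤ_p` is continuous);
* **`exists_scalar`** — there is `c ∈ ℤ_p` with `f x − N·x ∈ p^k G + G_tors` for all `x` whenever `N ≡ c (mod p^k)`, and `c` satisfies
  every relation `f² + m₁ f = c₁` that `f` does; `scalar_unique` — `c` is unique; `isOfFinAddOrder_of_forall_exists` — no non-torsion
  point is divisible modulo torsion; **`exists_rankOne_rel`** — for `x₀` of infinite order and any `y`: `p^a y ≡ M x₀ (mod p^K G + G_tors)`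
  (the «cocyclic / `r = 1`» mechanism of Agboola's Prop. 6.11 in points currency).
File 2 (`…LocalPointsScalarDyadic`) instantiates this at the dyadic places of the S3c frame (`K` imaginary quadratic, `2 = v v̄`).

References: J. H. Silverman, *AEC* 2nd ed. (2009), Prop. VII.6.3 [SilvermanAEC2009]; A. Agboola, Compositio 143 (2007) §6 Prop. 6.11
[Agboola2007]; K. Rubin, LNM 1716 (1999) §3 Lemma 3.6 [Rubin1999].
-/

noncomputable section

open scoped Classical

set_option linter.dupNamespace false -- `Summit.BirchSwinnertonDyer.BirchSwinnertonDyer` (summit = problem) is the tree's layout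
set_option autoImplicit false

namespace Summit.BirchSwinnertonDyer.BirchSwinnertonDyer.Theorems.PrintCf2.LocalPointsScalar

/-! ## §1. Abstract: a group with a finite-index subgroup `≃+ ℤ_p` -/

section Abstract

variable {G : Type*} [AddCommGroup G] {p : ℕ} [hp : Fact p.Prime]

/-- **Coordinates.** If `U ≤ G` has finite index `m` and `e : U ≃+ ℤ_p`, the map `ξ(x) = e(m·x)/m ∈ ℚ_p` is additive, vanishes
exactly on the torsion of `G`, extends `e` on `U`, is bounded by `‖m‖⁻¹`, and its image is a `ℤ_p`-module (`t·ξ(x) = ξ(x')`).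
[folklore] -/
theorem exists_coord (U : AddSubgroup G) [U.FiniteIndex] (e : U ≃+ ℤ_[p]) :
    ∃ ξ : G →+ ℚ_[p],
      (∀ x, ξ x = 0 ↔ IsOfFinAddOrder x) ∧
      (∀ u : U, ξ u = ((e u : ℤ_[p]) : ℚ_[p])) ∧
      (∀ x, ‖ξ x‖ ≤ ‖((U.index : ℕ) : ℚ_[p])‖⁻¹) ∧
      (∀ (x : G) (t : ℤ_[p]), ∃ x' : G, ξ x' = (t : ℚ_[p]) * ξ x) := by
  set m : ℕ := U.index with hm_def
  have hm0 : m ≠ 0 := AddSubgroup.FiniteIndex.index_ne_zero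
  have hmQ : ((m : ℕ) : ℚ_[p]) ≠ 0 := by exact_mod_cast hm0
  -- `ψ : x ↦ m • x ∈ U`
  let ψ : G →+ U := (nsmulAddMonoidHom m : G →+ G).codRestrict U (fun x ↦ U.nsmul_index_mem x)
  have hψ : ∀ x, ((ψ x : U) : G) = m • x := fun x ↦ rfl
  let ξ : G →+ ℚ_[p] :=
    (AddMonoidHom.mulLeft ((m : ℚ_[p])⁻¹)).comp
      ((PadicInt.Coe.ringHom : ℤ_[p] →+* ℚ_[p]).toAddMonoidHom.comp (e.toAddMonoidHom.comp ψ))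
  have hξ : ∀ x, ξ x = ((m : ℚ_[p])⁻¹) * ((e (ψ x) : ℤ_[p]) : ℚ_[p]) := fun x ↦ rfl
  -- (ii) `ξ` extends `e`
  have hξU : ∀ u : U, ξ u = ((e u : ℤ_[p]) : ℚ_[p]) := by
    intro u
    have hu : ψ (u : G) = m • u := by
      apply Subtype.ext
      rw [hψ, AddSubgroupClass.coe_nsmul]
    rw [hξ, hu, map_nsmul, nsmul_eq_mul, PadicInt.coe_mul, PadicInt.coe_natCast, inv_mul_cancel_left₀ hmQ]
  -- `m • ξ x = e (ψ x)`
  have hmξ : ∀ x, (m : ℚ_[p]) * ξ x = ((e (ψ x) : ℤ_[p]) : ℚ_[p]) := by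
    intro x; rw [hξ, mul_inv_cancel_left₀ hmQ]
  -- (i) kernel = torsion
  have hker : ∀ x, ξ x = 0 ↔ IsOfFinAddOrder x := by
    intro x
    constructor
    · intro hx
      have h1 : ((e (ψ x) : ℤ_[p]) : ℚ_[p]) = 0 := by rw [← hmξ, hx, mul_zero]
      have h2 : e (ψ x) = 0 := Subtype.ext h1
      have h3 : ψ x = 0 := by simpa using h2
      have h4 : m • x = 0 := by rw [← hψ, h3, ZeroMemClass.coe_zero]
      exact isOfFinAddOrder_iff_nsmul_eq_zero.mpr ⟨m, Nat.pos_of_ne_zero hm0, h4⟩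
    · intro hx
      obtain ⟨n, hn, hnx⟩ := isOfFinAddOrder_iff_nsmul_eq_zero.mp hx
      have h1 : n • ψ x = 0 := by
        apply Subtype.ext
        rw [AddSubgroupClass.coe_nsmul, hψ, ZeroMemClass.coe_zero, smul_comm, hnx, smul_zero]
      have h2 : n • e (ψ x) = 0 := by rw [← map_nsmul, h1, map_zero]
      have h3 : e (ψ x) = 0 := by
        rcases smul_eq_zero.mp h2 with h | h
        · exact absurd h (Nat.pos_iff_ne_zero.mp hn)
        · exact h
      rw [hξ, h3, PadicInt.coe_zero, mul_zero]
  -- (iii) bound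
  have hbd : ∀ x, ‖ξ x‖ ≤ ‖((m : ℕ) : ℚ_[p])‖⁻¹ := by
    intro x
    rw [hξ, norm_mul, norm_inv]
    exact mul_le_of_le_one_right (inv_nonneg.mpr (norm_nonneg _)) (PadicInt.norm_le_one _)
  -- (iv) the image is a `ℤ_p`-module
  have hmod : ∀ (x : G) (t : ℤ_[p]), ∃ x' : G, ξ x' = (t : ℚ_[p]) * ξ x := by
    intro x t
    -- `m = p^a m'`, `p ∤ m'`
    obtain ⟨a, m', hm', hmm'⟩ := Nat.exists_eq_pow_mul_and_not_dvd hm0 p hp.out.ne_one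
    have hm'u : IsUnit (m' : ℤ_[p]) := by
      rw [PadicInt.isUnit_iff]
      have h1 := PadicInt.norm_le_one (m' : ℤ_[p])
      have h2 : ¬ ‖(m' : ℤ_[p])‖ < 1 := by
        rw [← Int.cast_natCast, PadicInt.norm_int_lt_one_iff_dvd]
        exact_mod_cast hm'
      exact le_antisymm h1 (not_lt.mp h2)
    obtain ⟨w, hw⟩ := hm'u
    -- `p^a ξ x = m'⁻¹ e(ψ x)` is integral
    set E : ℤ_[p] := e (ψ x) with hE
    set z : ℤ_[p] := ((w⁻¹ : ℤ_[p]ˣ) : ℤ_[p]) * E with hz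
    have hm1 : (m : ℚ_[p]) = (p : ℚ_[p]) ^ a * (m' : ℚ_[p]) := by exact_mod_cast hmm'
    have hm'Q : (m' : ℚ_[p]) ≠ 0 := by
      intro h
      apply hmQ
      rw [hm1, h, mul_zero]
    have hwQ : ((w : ℤ_[p]) : ℚ_[p]) = (m' : ℚ_[p]) := by rw [hw, PadicInt.coe_natCast]
    have hzm : (z : ℚ_[p]) * (m' : ℚ_[p]) = (E : ℚ_[p]) := by
      rw [← hwQ, ← PadicInt.coe_mul, hz, mul_comm, ← mul_assoc, Units.mul_inv, one_mul]
    have hint : ((p : ℚ_[p]) ^ a) * ξ x = (z : ℚ_[p]) := by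
      have h1 : ((p : ℚ_[p]) ^ a * ξ x) * (m' : ℚ_[p]) = (z : ℚ_[p]) * (m' : ℚ_[p]) := by
        rw [hzm, ← hmξ x, hm1]; ring
      exact mul_right_cancel₀ hm'Q h1
    -- `t = appr t a + p^a t'`
    obtain ⟨t', ht'⟩ := Ideal.mem_span_singleton'.mp (PadicInt.appr_spec a t)
    refine ⟨(t.appr a) • x + ((e.symm (t' * z) : U) : G), ?_⟩
    rw [map_add, map_nsmul, hξU, AddEquiv.apply_symm_apply, PadicInt.coe_mul, ← hint, nsmul_eq_mul]
    have ht : (t : ℚ_[p]) = ((t.appr a : ℕ) : ℚ_[p]) + (t' : ℚ_[p]) * (p : ℚ_[p]) ^ a := by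
      have := congrArg (fun s : ℤ_[p] ↦ (s : ℚ_[p])) ht'
      simp only [PadicInt.coe_mul, PadicInt.coe_pow, PadicInt.coe_natCast, PadicInt.coe_sub] at this
      linear_combination -this
    rw [ht]; ring
  exact ⟨ξ, hker, hξU, hbd, hmod⟩

/-- **Bounded additive maps `ℤ_p → ℚ_p` are `ℤ_p`-linear**: `φ z = z · φ 1` (write `z = n + p^k z'` with `n ∈ ℕ`; the error
`p^k φ z'` has norm `≤ p^{-k} C`). [folklore] -/
theorem eq_mul_of_bounded (φ : ℤ_[p] →+ ℚ_[p]) (C : ℝ) (hC : ∀ z, ‖φ z‖ ≤ C) (z : ℤ_[p]) :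
    φ z = (z : ℚ_[p]) * φ 1 := by
  -- `ψ₀ z := φ z - z φ 1` is additive, kills `ℕ`, and is bounded
  have hnat : ∀ n : ℕ, φ n = (n : ℚ_[p]) * φ 1 := by
    intro n; rw [← nsmul_one, map_nsmul, nsmul_eq_mul]
  have hp1 : 1 < (p : ℝ) := by exact_mod_cast hp.out.one_lt
  have hp0 : 0 < (p : ℝ) := lt_trans zero_lt_one hp1
  set C' : ℝ := C + ‖φ 1‖ + 1 with hC'
  have hC'pos : 0 < C' := by
    have h0 : 0 ≤ C := le_trans (norm_nonneg _) (hC 0)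
    positivity
  have hbound : ∀ w : ℤ_[p], ‖φ w - (w : ℚ_[p]) * φ 1‖ ≤ C' := by
    intro w
    calc ‖φ w - (w : ℚ_[p]) * φ 1‖ ≤ ‖φ w‖ + ‖(w : ℚ_[p]) * φ 1‖ := norm_sub_le _ _
      _ ≤ C + ‖φ 1‖ := by
          refine add_le_add (hC w) ?_
          rw [norm_mul]
          exact mul_le_of_le_one_left (norm_nonneg _) (PadicInt.norm_le_one w)
      _ ≤ C' := by linarith
  -- at every depth `k` the defect has norm `≤ p^{-k} C'`
  have hk : ∀ k : ℕ, ‖φ z - (z : ℚ_[p]) * φ 1‖ ≤ ((p : ℝ)⁻¹) ^ k * C' := by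
    intro k
    obtain ⟨t', ht'⟩ := Ideal.mem_span_singleton'.mp (PadicInt.appr_spec k z)
    have hz : z = (z.appr k : ℤ_[p]) + (p ^ k : ℕ) • t' := by
      rw [nsmul_eq_mul]; push_cast; linear_combination -ht'
    have hzQ : (z : ℚ_[p]) = ((z.appr k : ℕ) : ℚ_[p]) + (p : ℚ_[p]) ^ k * (t' : ℚ_[p]) := by
      have := congrArg (fun s : ℤ_[p] ↦ (s : ℚ_[p])) ht'
      simp only [PadicInt.coe_mul, PadicInt.coe_pow, PadicInt.coe_natCast, PadicInt.coe_sub] at this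
      linear_combination -this
    have hφz : φ z = ((z.appr k : ℕ) : ℚ_[p]) * φ 1 + (p : ℚ_[p]) ^ k * φ t' := by
      conv_lhs => rw [hz]
      rw [map_add, map_nsmul, hnat, nsmul_eq_mul]
      push_cast
      ring
    have hdef : φ z - (z : ℚ_[p]) * φ 1 = ((p : ℚ_[p]) ^ k) * (φ t' - (t' : ℚ_[p]) * φ 1) := by
      rw [hφz, hzQ]; ring
    rw [hdef, norm_mul, norm_pow, Padic.norm_p]
    exact mul_le_mul_of_nonneg_left (hbound t') (pow_nonneg (inv_nonneg.mpr hp0.le) k)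
  -- hence it is `0`
  by_contra hne
  have hpos : 0 < ‖φ z - (z : ℚ_[p]) * φ 1‖ := norm_pos_iff.mpr (sub_ne_zero.mpr hne)
  obtain ⟨k, hk'⟩ := exists_pow_lt_of_lt_one (div_pos hpos hC'pos) (inv_lt_one_of_one_lt₀ hp1)
  have := hk k
  rw [lt_div_iff₀ hC'pos] at hk'
  linarith

/-- **THE SCALAR OF AN ENDOMORPHISM.** Let `U ≤ G` have finite index with `e : U ≃+ ℤ_p` (so `G/G_tors` is a `ℤ_p`-line up to
finite index) and let `f : G →+ G` be additive. Then there is a `p`-adic integer `c` such that `f` IS MULTIPLICATION BY `c` MODULO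
TORSION: for every `k` and every integer `N ≡ c (mod p^k)`, `f x − N·x ∈ p^k·G + G_tors` for all `x`; and every polynomial
relation `f² + m₁ f = c₁` satisfied by `f` is satisfied by `c`. (Every additive endomorphism of `ℤ_p` is continuous, hence a
scalar: `eq_mul_of_bounded`.) [folklore] -/
theorem exists_scalar (U : AddSubgroup G) [U.FiniteIndex] (e : U ≃+ ℤ_[p]) (f : G →+ G) :
    ∃ c : ℤ_[p],
      (∀ (k : ℕ) (N : ℤ), ((N : ℤ_[p]) - c) ∈ Ideal.span {(p : ℤ_[p]) ^ k} →
        ∀ x : G, ∃ y : G, IsOfFinAddOrder (f x - N • x - ((p : ℤ) ^ k) • y)) ∧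
      (∀ (m₁ c₁ : ℤ), (∀ x, f (f x) + m₁ • f x = c₁ • x) → c * c + m₁ * c = c₁) := by
  obtain ⟨ξ, hker, hξU, hbd, hmod⟩ := exists_coord U e
  set B : ℝ := ‖((U.index : ℕ) : ℚ_[p])‖⁻¹ with hB
  -- `φ z := ξ (f (e⁻¹ z))`, bounded additive, hence `φ z = z c₀`
  let φ : ℤ_[p] →+ ℚ_[p] := ξ.comp (f.comp (U.subtype.comp e.symm.toAddMonoidHom))
  have hφ : ∀ w : ℤ_[p], φ w = ξ (f ((e.symm w : U) : G)) := fun w ↦ rfl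
  set c₀ : ℚ_[p] := φ 1 with hc₀
  have hφlin : ∀ w : ℤ_[p], φ w = (w : ℚ_[p]) * c₀ := eq_mul_of_bounded φ B (fun w ↦ by rw [hφ]; exact hbd _)
  -- `ξ (f x) = c₀ ξ x`
  have hm0 : U.index ≠ 0 := AddSubgroup.FiniteIndex.index_ne_zero
  have hmQ : ((U.index : ℕ) : ℚ_[p]) ≠ 0 := by exact_mod_cast hm0
  have hξf : ∀ x : G, ξ (f x) = c₀ * ξ x := by
    intro x
    have hxU : U.index • x ∈ U := U.nsmul_index_mem x
    set u : U := ⟨U.index • x, hxU⟩ with hu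
    have h1 : ξ (f ((e.symm (e u) : U) : G)) = ((e u : ℤ_[p]) : ℚ_[p]) * c₀ := by rw [← hφ, hφlin]
    rw [AddEquiv.symm_apply_apply, ← hξU u] at h1
    change ξ (f (U.index • x)) = ξ (U.index • x) * c₀ at h1
    rw [map_nsmul, map_nsmul, map_nsmul, nsmul_eq_mul, nsmul_eq_mul] at h1
    have h2 : ((U.index : ℕ) : ℚ_[p]) * ξ (f x) = ((U.index : ℕ) : ℚ_[p]) * (c₀ * ξ x) := by rw [h1]; ring
    exact mul_left_cancel₀ hmQ h2
  -- `c₀` is a `p`-adic integer: its powers are bounded (`c₀^n = ξ (f^n x₁)`)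
  set x₁ : G := ((e.symm 1 : U) : G) with hx₁
  have hξx₁ : ξ x₁ = 1 := by rw [hx₁, hξU, AddEquiv.apply_symm_apply, PadicInt.coe_one]
  have hpow : ∀ n : ℕ, ξ ((⇑f)^[n] x₁) = c₀ ^ n := by
    intro n
    induction n with
    | zero => rw [pow_zero, Function.iterate_zero_apply]; exact hξx₁
    | succ n ih => rw [Function.iterate_succ_apply', hξf, ih, pow_succ']
  have hc₀ : ‖c₀‖ ≤ 1 := by
    by_contra h
    obtain ⟨n, hn⟩ := pow_unbounded_of_one_lt B (not_le.mp h)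
    have := hbd ((⇑f)^[n] x₁)
    rw [hpow, norm_pow] at this
    exact absurd (lt_of_lt_of_le hn this) (lt_irrefl _)
  refine ⟨⟨c₀, hc₀⟩, ?_, ?_⟩
  · -- (A) `f x − N x ∈ p^k G + tors` for `N ≡ c (mod p^k)`
    intro k N hN x
    obtain ⟨t, ht⟩ := Ideal.mem_span_singleton'.mp hN
    obtain ⟨x', hx'⟩ := hmod x (-t)
    refine ⟨x', (hker _).mp ?_⟩
    have htQ : (N : ℚ_[p]) - c₀ = (t : ℚ_[p]) * (p : ℚ_[p]) ^ k := by
      have := congrArg (fun s : ℤ_[p] ↦ (s : ℚ_[p])) ht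
      simp only [PadicInt.coe_mul, PadicInt.coe_pow, PadicInt.coe_natCast, PadicInt.coe_sub, PadicInt.coe_intCast] at this
      rw [← this]
    rw [map_sub, map_sub, map_zsmul, map_zsmul, hξf, hx', zsmul_eq_mul, zsmul_eq_mul, PadicInt.coe_neg]
    push_cast
    linear_combination (-(ξ x)) * htQ
  · -- (B) relations transfer
    intro m₁ c₁ hrel
    have h := congrArg ξ (hrel x₁)
    rw [map_add, map_zsmul, map_zsmul, hξf, hξf, hξx₁, zsmul_eq_mul, zsmul_eq_mul, mul_one, mul_one] at h
    apply Subtype.ext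
    change c₀ * c₀ + ((m₁ : ℤ_[p]) : ℚ_[p]) * c₀ = ((c₁ : ℤ_[p]) : ℚ_[p])
    rw [PadicInt.coe_intCast, PadicInt.coe_intCast]
    linear_combination h

/-- An integer congruent to a `p`-adic integer modulo `p^k`: `appr`. [folklore] -/
theorem exists_int_sub_mem_span (c : ℤ_[p]) (k : ℕ) :
    ∃ N : ℤ, ((N : ℤ_[p]) - c) ∈ Ideal.span {(p : ℤ_[p]) ^ k} := by
  refine ⟨(c.appr k : ℤ), ?_⟩
  rw [Int.cast_natCast, ← neg_sub]
  exact (Ideal.neg_mem_iff _).mpr (PadicInt.appr_spec k c)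

/-- **No divisible elements modulo torsion**: if `x ∈ p^K·G + G_tors` for every `K`, then `x` is torsion
(`ξ x ∈ ⋂ p^K ‖m‖⁻¹ ℤ_p = 0`). [folklore] -/
theorem isOfFinAddOrder_of_forall_exists (U : AddSubgroup G) [U.FiniteIndex] (e : U ≃+ ℤ_[p]) {x : G}
    (hx : ∀ K : ℕ, ∃ y : G, IsOfFinAddOrder (x - ((p : ℤ) ^ K) • y)) : IsOfFinAddOrder x := by
  obtain ⟨ξ, hker, -, hbd, -⟩ := exists_coord U e
  set B : ℝ := ‖((U.index : ℕ) : ℚ_[p])‖⁻¹ with hB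
  have hp1 : 1 < (p : ℝ) := by exact_mod_cast hp.out.one_lt
  have hp0 : 0 < (p : ℝ) := lt_trans zero_lt_one hp1
  have hK : ∀ K : ℕ, ‖ξ x‖ ≤ ((p : ℝ)⁻¹) ^ K * (B + 1) := by
    intro K
    obtain ⟨y, hy⟩ := hx K
    have h0 := (hker _).mpr hy
    rw [map_sub, map_zsmul, sub_eq_zero, zsmul_eq_mul] at h0
    rw [h0, norm_mul]
    push_cast
    rw [norm_pow, Padic.norm_p]
    exact mul_le_mul_of_nonneg_left (le_trans (hbd y) (by linarith)) (pow_nonneg (inv_nonneg.mpr hp0.le) K)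
  rw [← hker]
  by_contra hne
  have hpos : 0 < ‖ξ x‖ := norm_pos_iff.mpr hne
  have hB1 : 0 < B + 1 := by
    have : 0 ≤ B := inv_nonneg.mpr (norm_nonneg _)
    linarith
  obtain ⟨K, hK'⟩ := exists_pow_lt_of_lt_one (div_pos hpos hB1) (inv_lt_one_of_one_lt₀ hp1)
  have := hK K
  rw [lt_div_iff₀ hB1] at hK'
  linarith

/-- **Uniqueness of the scalar**: two `p`-adic integers `c, c'` that both describe `f` modulo `p^k·G + G_tors` for all `k`
coincide (`G` has a point of infinite order, e.g. `e⁻¹ 1`). [folklore] -/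
theorem scalar_unique (U : AddSubgroup G) [U.FiniteIndex] (e : U ≃+ ℤ_[p]) (f : G →+ G) {c c' : ℤ_[p]}
    (hc : ∀ (k : ℕ) (N : ℤ), ((N : ℤ_[p]) - c) ∈ Ideal.span {(p : ℤ_[p]) ^ k} →
      ∀ x : G, ∃ y : G, IsOfFinAddOrder (f x - N • x - ((p : ℤ) ^ k) • y))
    (hc' : ∀ (k : ℕ) (N : ℤ), ((N : ℤ_[p]) - c') ∈ Ideal.span {(p : ℤ_[p]) ^ k} →
      ∀ x : G, ∃ y : G, IsOfFinAddOrder (f x - N • x - ((p : ℤ) ^ k) • y)) :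
    c = c' := by
  -- `(c - c') • x₁ ∈ p^k G + tors` for every `k`, for the non-torsion point `x₁ = e⁻¹ 1`; so `c − c' ∈ ⋂ p^k ℤ_p`-ish
  obtain ⟨ξ, hker, hξU, hbd, -⟩ := exists_coord U e
  set x₁ : G := ((e.symm 1 : U) : G) with hx₁
  have hξx₁ : ξ x₁ = 1 := by rw [hx₁, hξU, AddEquiv.apply_symm_apply, PadicInt.coe_one]
  set B : ℝ := ‖((U.index : ℕ) : ℚ_[p])‖⁻¹ with hB
  have hp1 : 1 < (p : ℝ) := by exact_mod_cast hp.out.one_lt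
  have hp0 : 0 < (p : ℝ) := lt_trans zero_lt_one hp1
  have hB0 : 0 ≤ B := inv_nonneg.mpr (norm_nonneg _)
  have hk : ∀ k : ℕ, ‖((c : ℤ_[p]) : ℚ_[p]) - c'‖ ≤ ((p : ℝ)⁻¹) ^ k * (B + 1) := by
    intro k
    obtain ⟨N, hN⟩ := exists_int_sub_mem_span c k
    obtain ⟨N', hN'⟩ := exists_int_sub_mem_span c' k
    obtain ⟨y, hy⟩ := hc k N hN x₁
    obtain ⟨y', hy'⟩ := hc' k N' hN' x₁
    have h0 := (hker _).mpr hy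
    have h0' := (hker _).mpr hy'
    rw [map_sub, map_sub, map_zsmul, map_zsmul, hξx₁, zsmul_eq_mul, zsmul_eq_mul, mul_one] at h0 h0'
    -- `N − N' = p^k (ξ y' − ξ y)`... in `ℚ_p`
    have hNN : ((N : ℚ_[p]) - N') = ((p : ℚ_[p]) ^ k) * (ξ y' - ξ y) := by
      push_cast at h0 h0'
      linear_combination h0' - h0
    have hnormNN : ‖((N : ℚ_[p]) - N')‖ ≤ ((p : ℝ)⁻¹) ^ k * B := by
      rw [hNN, norm_mul, norm_pow, Padic.norm_p]
      refine mul_le_mul_of_nonneg_left ?_ (pow_nonneg (inv_nonneg.mpr hp0.le) k)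
      rw [sub_eq_add_neg]
      exact le_trans (Padic.nonarchimedean _ _) (max_le (hbd _) (by rw [norm_neg]; exact hbd _))
    have hpk : ((p : ℝ)⁻¹) ^ k = (p : ℝ) ^ (-(k : ℤ)) := by rw [zpow_neg, zpow_natCast, inv_pow]
    have hcN : ‖((N : ℤ_[p]) : ℚ_[p]) - c‖ ≤ ((p : ℝ)⁻¹) ^ k := by
      rw [hpk, ← PadicInt.coe_sub, PadicInt.padic_norm_e_of_padicInt, PadicInt.norm_le_pow_iff_mem_span_pow]
      exact hN
    have hcN' : ‖((N' : ℤ_[p]) : ℚ_[p]) - c'‖ ≤ ((p : ℝ)⁻¹) ^ k := by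
      rw [hpk, ← PadicInt.coe_sub, PadicInt.padic_norm_e_of_padicInt, PadicInt.norm_le_pow_iff_mem_span_pow]
      exact hN'
    have hsplit : ((c : ℤ_[p]) : ℚ_[p]) - c' =
        -((((N : ℤ_[p]) : ℚ_[p]) - c)) + (((N : ℚ_[p]) - N') + ((((N' : ℤ_[p]) : ℚ_[p]) - c'))) := by
      push_cast; ring
    rw [hsplit]
    refine le_trans (Padic.nonarchimedean _ _) (max_le ?_ (le_trans (Padic.nonarchimedean _ _) (max_le ?_ ?_)))
    · rw [norm_neg]; exact le_trans hcN (by nlinarith [pow_nonneg (inv_nonneg.mpr hp0.le) k])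
    · exact le_trans hnormNN (by nlinarith [pow_nonneg (inv_nonneg.mpr hp0.le) k])
    · exact le_trans hcN' (by nlinarith [pow_nonneg (inv_nonneg.mpr hp0.le) k])
  by_contra hne
  have hne' : ((c : ℤ_[p]) : ℚ_[p]) - c' ≠ 0 := by
    intro h
    exact hne (Subtype.ext (sub_eq_zero.mp h))
  have hpos : 0 < ‖((c : ℤ_[p]) : ℚ_[p]) - c'‖ := norm_pos_iff.mpr hne'
  have hB1 : 0 < B + 1 := by linarith
  obtain ⟨k, hk'⟩ := exists_pow_lt_of_lt_one (div_pos hpos hB1) (inv_lt_one_of_one_lt₀ hp1)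
  have := hk k
  rw [lt_div_iff₀ hB1] at hk'
  linarith

/-- **Rank-one relation**: for a point `x₀` of infinite order and any `y`, some `p^a·y` is a `ℤ_p`-multiple of `x₀` modulo
torsion: `∃ a, ∀ K, ∃ M y', p^a y − M x₀ − p^K y' ∈ G_tors` (`G/G_tors` embeds in the line `ℚ_p·ξ(x₀)`). [folklore] -/
theorem exists_rankOne_rel (U : AddSubgroup G) [U.FiniteIndex] (e : U ≃+ ℤ_[p]) {x₀ : G}
    (hx₀ : ¬ IsOfFinAddOrder x₀) (y : G) :
    ∃ a : ℕ, ∀ K : ℕ, ∃ (M : ℤ) (y' : G), IsOfFinAddOrder (((p : ℤ) ^ a) • y - M • x₀ - ((p : ℤ) ^ K) • y') := by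
  obtain ⟨ξ, hker, -, -, hmod⟩ := exists_coord U e
  have hξ0 : ξ x₀ ≠ 0 := fun h ↦ hx₀ ((hker _).mp h)
  set q : ℚ_[p] := ξ y / ξ x₀ with hq
  have hp1 : 1 < (p : ℝ) := by exact_mod_cast hp.out.one_lt
  have hp0 : 0 < (p : ℝ) := lt_trans zero_lt_one hp1
  -- `p^a q ∈ ℤ_p` for `a` large
  obtain ⟨a, ha⟩ := pow_unbounded_of_one_lt ‖q‖ hp1
  have hs : ‖(p : ℚ_[p]) ^ a * q‖ ≤ 1 := by
    rw [norm_mul, norm_pow, Padic.norm_p, inv_pow]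
    rw [inv_mul_le_iff₀ (pow_pos hp0 a), mul_one]
    exact ha.le
  set s : ℤ_[p] := ⟨(p : ℚ_[p]) ^ a * q, hs⟩ with hs_def
  refine ⟨a, fun K ↦ ?_⟩
  obtain ⟨t', ht'⟩ := Ideal.mem_span_singleton'.mp (PadicInt.appr_spec K s)
  obtain ⟨y', hy'⟩ := hmod x₀ t'
  refine ⟨(s.appr K : ℤ), y', (hker _).mp ?_⟩
  have hsQ : (s : ℚ_[p]) = ((s.appr K : ℕ) : ℚ_[p]) + (t' : ℚ_[p]) * (p : ℚ_[p]) ^ K := by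
    have := congrArg (fun w : ℤ_[p] ↦ (w : ℚ_[p])) ht'
    simp only [PadicInt.coe_mul, PadicInt.coe_pow, PadicInt.coe_natCast, PadicInt.coe_sub] at this
    linear_combination -this
  have hsq : (s : ℚ_[p]) * ξ x₀ = (p : ℚ_[p]) ^ a * ξ y := by
    change ((p : ℚ_[p]) ^ a * q) * ξ x₀ = _
    rw [hq, mul_assoc, div_mul_cancel₀ _ hξ0]
  rw [map_sub, map_sub, map_zsmul, map_zsmul, map_zsmul, hy', zsmul_eq_mul, zsmul_eq_mul, zsmul_eq_mul]
  push_cast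
  rw [← hsq, hsQ]
  ring

end Abstract

end Summit.BirchSwinnertonDyer.BirchSwinnertonDyer.Theorems.PrintCf2.LocalPointsScalar

end
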